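import Literature.RingTheory.Henselian.FiniteAlgebraProductOfLocalizations
import Literature.RingTheory.Idempotents.FiniteAlgebraLocalFactorsRank
import Mathlib.LinearAlgebra.FreeModule.Finite.Matrix
import Mathlib.RingTheory.LocalRing.Module
import HarnessLib

/-!
# A finite free algebra over a henselian local DOMAIN with «all points rational» (`#Hom_R(B, R) = rank_R B`): every point of the special fibre,
# with values in ANY field, is the specialisation of a section ([SerreTate1968] §1 Lemma 1, mechanism; [StacksProject] Tags 04GG, 09HS)

Topic `Literature/RingTheory/Henselian`, namespace `Literature.RingTheory.Henselian`.  THEOREMS ONLY (no definition, no named fact, no instance, no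
notation, no `sorry`).  Cell `pub/hodgecm-mathlib` (D-0151 ∕ D-0183 floor 0), P6 «MOD programme», sub-line P6b «CONNECTED–ÉTALE»
(`Cruxes/HLiu418/Lines/F0_P6b_ConnectedEtale.lean`): the ALGEBRA of the banked letter **(b1dg) `reductionSurjective_ofCardSections`** (the
base-generic — F-c2a ∕ DVR — form of (b1d): over a henselian local DOMAIN, `#G(R) = rank` replaces «`V ⊆ Ω = Ω̄`»); the scheme shell is ★-to-be
`GroupSchemes/ReductionSurjectiveOfCardSections`.  Generic, count-neutral capital `--supports stmt-HodgeConjecture-24832`.  HONEST LABEL: HC_CM is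
proved only modulo the printed citations until rung 0 closes; this file pays no letter.

THE MATHEMATICS.  `R` henselian local, `B` module-finite over `R`: `B = ∏ᵢ Bᵢ` over a complete orthogonal family of idempotents `eᵢ` with LOCAL
corners `Bᵢ = B ⧸ (1 - eᵢ)` (★ `Henselian.exists_completeOrthogonalIdempotents_isLocalRing`, [StacksProject] Tag 04GG), and the `R`-points distribute
over the corners (★ `Idempotents.card_algHom_eq_sum`, `bijective_sigma_comp_mk`).
* §1 `algHom_apply_eq_algebraMap_section` — **a LOCAL `R`-algebra `C`, integral over the local `R`, WITH A SECTION `s : C →ₐ[R] R` has only one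
  point with values in any `R`-field `k` whose structure map kills `𝔪_R`**: every `g : C →ₐ[R] k` is `k ∘ s` (`g` kills `ker s ⊆ 𝔫_C`, because
  `ker g` is a prime over `𝔪_R`, hence maximal by integrality — Mathlib `Ideal.isMaximal_of_isIntegral_of_isMaximal_comap` — hence `= 𝔫_C`).
* §2 `card_algHom_corner_eq_finrank_of_card_eq_finrank` ∕ `nonempty_algHom_corner_of_card_eq_finrank` — **over a local DOMAIN `R`, if a finite free
  `B` has `#(B →ₐ[R] R) = rank_R B` then EVERY corner `Bᵢ` has `#(Bᵢ →ₐ[R] R) = rank_R Bᵢ ≥ 1`**, in particular a section: Dedekind's bound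
  `#(Bᵢ →ₐ[R] R) ≤ rank_R Bᵢ` (Mathlib `card_algHom_le_finrank`, [StacksProject] Tag 09HS) termwise, and the two sums agree (★ `card_algHom_eq_sum`,
  ★ `finrank_eq_sum_finrank_quotient`).
* §3 **`exists_algHom_comp_eq_of_card_algHom_eq_finrank`** — the head: `R` a henselian local DOMAIN, `B` finite free with `#(B →ₐ[R] R) = rank_R B`,
  `k` any field, `φ : κ(R) → k`; every ring map `χ : B → k` with `χ ∘ (R → B) = φ ∘ residue` is `φ ∘ residue ∘ ψ` for a section `ψ : B →ₐ[R] R`.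
  The count hypothesis is load-bearing (ordinary `E[p]` over `W(κ̄)`: the non-unit corners have no section, their `κ̄`-points do not lift), and
  Dedekind's bound `#(Bᵢ →ₐ[R] R) ≤ rank_R Bᵢ` needs the DOMAIN `R` (`R = k[ε]`, `B = R[x]⧸(x²)` has `|k| ≥ 2 = rank` sections on ONE corner).

## References
* [SerreTate1968] J.-P. Serre, J. Tate, *Good reduction of abelian varieties*, Ann. of Math. 88 (1968), §1 Lemma 1 (reduction on points of a finite flat
  group scheme over a henselian base; the mechanism «each local factor with a rational point has residue field `κ`»).
* [StacksProject] The Stacks Project, Tag 04GG (finite algebras over henselian local rings are products of local rings), Tag 09HS (`#Mor ≤ degree`,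
  linear independence of characters), Tag 00U3.
-/

set_option autoImplicit false

universe u v w

open IsLocalRing

namespace Literature.RingTheory.Henselian

/-! ## §1 A local algebra with a section has one point in every residue-field extension -/

/-- **A local, integral `R`-algebra with a section has a single `k`-point for every field `k` under `κ(R)`.**  `R` local, `C` a LOCAL `R`-algebra
integral over `R` (e.g. module-finite), `s : C →ₐ[R] R` a section, `k` a field with an `R`-algebra structure killing `𝔪_R` (i.e. factoring through
`κ(R)`): every `R`-algebra map `g : C → k` is `c ↦ algebraMap R k (s c)`.  Indeed `g (c - s c) = 0` because `c - s c ∈ ker s ⊆ 𝔫_C = ker g`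
(`ker g` is a prime of `C` over the maximal `𝔪_R`, hence maximal). [cite: StacksProject, Tag 04GG] [cite: SerreTate1968, §1 Lemma 1] -/
theorem algHom_apply_eq_algebraMap_section {R : Type u} [CommRing R] [IsLocalRing R] {C : Type v} [CommRing C] [Algebra R C] [IsLocalRing C]
    [Algebra.IsIntegral R C] (s : C →ₐ[R] R) {k : Type w} [Field k] [Algebra R k]
    (hk : maximalIdeal R ≤ RingHom.ker (algebraMap R k)) (g : C →ₐ[R] k) (c : C) : g c = algebraMap R k (s c) := by
  -- `ker g` is a prime of `C` lying over `𝔪_R`, hence maximal, hence the maximal ideal of `C`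
  have hprime : (RingHom.ker (g : C →+* k)).IsPrime := RingHom.ker_isPrime _
  have hcomap : (RingHom.ker (g : C →+* k)).comap (algebraMap R C) = maximalIdeal R := by
    refine ((IsLocalRing.maximalIdeal.isMaximal R).eq_of_le ?_ ?_).symm
    · rw [Ne, Ideal.comap_eq_top_iff]
      exact hprime.ne_top
    · intro r hr
      rw [Ideal.mem_comap, RingHom.mem_ker, AlgHom.coe_toRingHom, AlgHom.commutes]
      exact hk hr
  haveI := hprime
  have hmax : (RingHom.ker (g : C →+* k)).IsMaximal :=
    Ideal.isMaximal_of_isIntegral_of_isMaximal_comap (R := R) _ (hcomap ▸ IsLocalRing.maximalIdeal.isMaximal R)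
  have hker : RingHom.ker (g : C →+* k) = maximalIdeal C := IsLocalRing.eq_maximalIdeal hmax
  -- `ker s ⊆ 𝔫_C`
  have hs : RingHom.ker (s : C →+* R) ≤ maximalIdeal C :=
    IsLocalRing.le_maximalIdeal (RingHom.ker_ne_top _)
  -- `c - s c ∈ ker s`
  have hd : c - algebraMap R C (s c) ∈ RingHom.ker (s : C →+* R) := by
    rw [RingHom.mem_ker, map_sub, AlgHom.coe_toRingHom, AlgHom.commutes, Algebra.algebraMap_self, RingHom.id_apply, sub_self]
  have h0 : g (c - algebraMap R C (s c)) = 0 := by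
    have := hs hd
    rw [← hker, RingHom.mem_ker] at this
    exact this
  rwa [map_sub, AlgHom.commutes, sub_eq_zero] at h0

/-! ## §2 Counting: `#(B →ₐ[R] R) = rank B` forces a section on every corner -/

section Count

variable {R : Type u} [CommRing R] [IsDomain R] [IsLocalRing R] {B : Type v} [CommRing B] [Algebra R B] [Module.Finite R B] [Module.Free R B]
  {n : ℕ} {e : Fin n → B} (he : CompleteOrthogonalIdempotents e)

include he in
/-- **Termwise equality in Dedekind's bound.**  `R` a local domain, `B` finite free with `#(B →ₐ[R] R) = rank_R B`, `e` a complete orthogonal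
family of idempotents: every corner `B ⧸ (1 - eᵢ)` has exactly `rank_R (B ⧸ (1 - eᵢ))` sections (`≤` is Mathlib `card_algHom_le_finrank`; the sums
over `i` agree by ★ `card_algHom_eq_sum` and ★ `finrank_eq_sum_finrank_quotient`). [cite: StacksProject, Tag 09HS] [cite: StacksProject, Tag 04GG] -/
theorem card_algHom_corner_eq_finrank_of_card_eq_finrank (hcard : Nat.card (B →ₐ[R] R) = Module.finrank R B) (i : Fin n) :
    Nat.card ((B ⧸ Ideal.span {1 - e i}) →ₐ[R] R) = Module.finrank R (B ⧸ Ideal.span {1 - e i}) := by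
  classical
  haveI : ∀ j, Module.Free R (B ⧸ Ideal.span {1 - e j}) := fun j =>
    Literature.RingTheory.Idempotents.free_quotient_span_one_sub (R := R) (he.idem j)
  have hR : ∀ x : R, IsIdempotentElem x → x = 0 ∨ x = 1 := fun x hx => IsIdempotentElem.iff_eq_zero_or_one.mp hx
  have hle : ∀ j ∈ (Finset.univ : Finset (Fin n)),
      Nat.card ((B ⧸ Ideal.span {1 - e j}) →ₐ[R] R) ≤ Module.finrank R (B ⧸ Ideal.span {1 - e j}) :=
    fun j _ => card_algHom_le_finrank R (B ⧸ Ideal.span {1 - e j}) R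
  have hsum : ∑ j, Nat.card ((B ⧸ Ideal.span {1 - e j}) →ₐ[R] R) = ∑ j, Module.finrank R (B ⧸ Ideal.span {1 - e j}) := by
    rw [← Literature.RingTheory.Idempotents.card_algHom_eq_sum hR he,
      ← Literature.RingTheory.Idempotents.finrank_eq_sum_finrank_quotient (R := R) he, hcard]
  exact (Finset.sum_eq_sum_iff_of_le hle).mp hsum i (Finset.mem_univ i)

include he in
/-- … in particular every LOCAL corner has a section `B ⧸ (1 - eᵢ) →ₐ[R] R` (a non-trivial free module has positive rank).
[cite: StacksProject, Tag 09HS] [cite: SerreTate1968, §1 Lemma 1] -/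
theorem nonempty_algHom_corner_of_card_eq_finrank (hcard : Nat.card (B →ₐ[R] R) = Module.finrank R B) (i : Fin n)
    [Nontrivial (B ⧸ Ideal.span {1 - e i})] : Nonempty ((B ⧸ Ideal.span {1 - e i}) →ₐ[R] R) := by
  haveI : Module.Free R (B ⧸ Ideal.span {1 - e i}) :=
    Literature.RingTheory.Idempotents.free_quotient_span_one_sub (R := R) (he.idem i)
  have hpos : 0 < Module.finrank R (B ⧸ Ideal.span {1 - e i}) := Module.finrank_pos
  rw [← card_algHom_corner_eq_finrank_of_card_eq_finrank he hcard i] at hpos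
  exact (Nat.card_pos_iff.mp hpos).1

end Count

/-! ## §3 The head: every point of the special fibre is the specialisation of a section -/

/-- **Over a henselian local DOMAIN, a finite free algebra with `#(B →ₐ[R] R) = rank_R B` has surjective reduction on points, with values in any
field.**  For a field `k`, `φ : κ(R) → k` and a ring map `χ : B → k` with `χ ∘ (R → B) = φ ∘ residue`, there is a section `ψ : B →ₐ[R] R` with
`φ ∘ residue ∘ ψ = χ`.  Proof: `B = ∏ᵢ Bᵢ` with local corners (henselian); `χ` factors through exactly one corner `Bᵢ` (★ `bijective_sigma_comp_mk`);
`Bᵢ` has a section `sᵢ` (§2); by §1 the induced point of `Bᵢ` is `φ ∘ residue ∘ sᵢ`; take `ψ = sᵢ ∘ (B → Bᵢ)`.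
[cite: SerreTate1968, §1 Lemma 1] [cite: StacksProject, Tag 04GG] -/
theorem exists_algHom_comp_eq_of_card_algHom_eq_finrank {R : Type u} [CommRing R] [IsDomain R] [HenselianLocalRing R]
    {B : Type v} [CommRing B] [Algebra R B] [Module.Finite R B] [Module.Free R B]
    (hcard : Nat.card (B →ₐ[R] R) = Module.finrank R B)
    {k : Type w} [Field k] (φ : ResidueField R →+* k) (χ : B →+* k) (hχ : χ.comp (algebraMap R B) = φ.comp (residue R)) :
    ∃ ψ : B →ₐ[R] R, (φ.comp (residue R)).comp (ψ : B →+* R) = χ := by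
  classical
  -- `k` as an `R`-algebra through `φ ∘ residue`; `χ` as an `R`-algebra map
  letI : Algebra R k := (φ.comp (residue R)).toAlgebra
  have halg : algebraMap R k = φ.comp (residue R) := rfl
  have hk : maximalIdeal R ≤ RingHom.ker (algebraMap R k) := fun r hr => by
    rw [RingHom.mem_ker, halg, RingHom.comp_apply, (IsLocalRing.residue_eq_zero_iff r).mpr hr, map_zero]
  have hcomm : ∀ r, χ (algebraMap R B r) = algebraMap R k r := fun r => by
    rw [halg, ← RingHom.comp_apply, hχ]
  let χa : B →ₐ[R] k := AlgHom.mk χ hcomm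
  -- the local corners of `B`
  obtain ⟨n, e, he, hloc⟩ := exists_completeOrthogonalIdempotents_isLocalRing R (S := B)
  have hkid : ∀ x : k, IsIdempotentElem x → x = 0 ∨ x = 1 := fun x hx => IsIdempotentElem.iff_eq_zero_or_one.mp hx
  -- `χ` factors through one corner
  obtain ⟨⟨i, g⟩, hg⟩ := (Literature.RingTheory.Idempotents.bijective_sigma_comp_mk (Ω := k) hkid he).2 χa
  haveI := hloc i
  -- that corner has a section
  obtain ⟨s⟩ := nonempty_algHom_corner_of_card_eq_finrank he hcard i
  haveI : Module.Finite R (B ⧸ Ideal.span {1 - e i}) := inferInstance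
  haveI : Algebra.IsIntegral R (B ⧸ Ideal.span {1 - e i}) := Algebra.IsIntegral.of_finite R _
  refine ⟨s.comp (Ideal.Quotient.mkₐ R (Ideal.span {1 - e i})), RingHom.ext fun b => ?_⟩
  have h1 : χ b = χa b := rfl
  have h2 : χa b = g (Ideal.Quotient.mkₐ R (Ideal.span {1 - e i}) b) := by
    rw [← hg]; rfl
  rw [h1, h2, algHom_apply_eq_algebraMap_section s hk g]
  rfl

end Literature.RingTheory.Henselian
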